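import Mathlib
import Summits.Ventures.HodgeRepro.Tier4.Target
import Summits.Ventures.HodgeRepro.Tier4.Common.TargetBall
import Summits.Ventures.HodgeRepro.Tier4.Common.AutForms
import Summits.Ventures.HodgeRepro.Tier4.Line3.BallChangeOfVariables

/-!
# Tier4/Line3/BoundaryDistance — the distance to the boundary after a ball action with bounded entries

Blind re-derivation cell `pub-hodge-repro`, Tier 4 «PROVE THE STEP» (README §9–§10), LINE L3, seat t4-L2-p1 (on L3.5
with t4-L2-p3); support lemma for (R3)(iv) of the residual `OffMainMass`: on a translate `M(F)` of a set `F` at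
distance `1 − r` from the boundary, `1 − nsq ≥ (1 − r) / (9 B²)` when the entries of `M ∈ U(2,1)` are bounded by `B`
(t4-L3-p1's `one_sub_nsq_actM`: `1 − nsq (actM M z) = (1 − nsq z) / ‖(M (z,1))₂‖²`, and `‖(M (z,1))₂‖ ≤ 3B` on the
closed ball).  What the residual still needs on top of this is the ARCHIMEDEAN SIZE of the coset representatives of
the level in `Γ` (`‖τ₀ (r i j)‖ ≤ C q₀^{kN}`) — the reduction-theoretic clause not yet in the tree.  Mathlib-level.
Nothing here asserts anything about the truth of (P); HC_CM is NOT proved by anyone in this repository.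
-/

set_option autoImplicit false

noncomputable section

namespace Summit.Ventures.HodgeRepro.Tier4.Line3

open Summit.Ventures.HodgeRepro.Tier4
open Matrix

/-- The coordinates of a point of the ball have norm at most `1`. -/
theorem norm_lift3_le_one {z : Fin 2 → ℂ} (hz : z ∈ ball) (j : Fin 3) : ‖lift3 z j‖ ≤ 1 := by
  have h : nsq z < 1 := hz
  unfold nsq at h
  have h0 : ‖z 0‖ ^ 2 ≤ 1 := by nlinarith [sq_nonneg ‖z 1‖]
  have h1 : ‖z 1‖ ^ 2 ≤ 1 := by nlinarith [sq_nonneg ‖z 0‖]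
  fin_cases j
  · exact (pow_le_one_iff_of_nonneg (norm_nonneg _) two_ne_zero).mp h0
  · exact (pow_le_one_iff_of_nonneg (norm_nonneg _) two_ne_zero).mp h1
  · simp [lift3]

/-- The denominator of the action is at most `3B` on the ball when the entries of `M` are bounded by `B`. -/
theorem norm_mulVec_lift3_two_le {M : Matrix (Fin 3) (Fin 3) ℂ} {B : ℝ} (hB : ∀ i j, ‖M i j‖ ≤ B)
    {z : Fin 2 → ℂ} (hz : z ∈ ball) : ‖(M *ᵥ lift3 z) 2‖ ≤ 3 * B := by
  have hB0 : 0 ≤ B := (norm_nonneg _).trans (hB 0 0)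
  calc ‖(M *ᵥ lift3 z) 2‖ = ‖∑ j, M 2 j * lift3 z j‖ := by simp [Matrix.mulVec, dotProduct]
    _ ≤ ∑ j, ‖M 2 j * lift3 z j‖ := norm_sum_le _ _
    _ ≤ ∑ j : Fin 3, B := by
        refine Finset.sum_le_sum fun j _ => ?_
        rw [norm_mul]
        calc ‖M 2 j‖ * ‖lift3 z j‖ ≤ B * 1 :=
              mul_le_mul (hB 2 j) (norm_lift3_le_one hz j) (norm_nonneg _) hB0
          _ = B := mul_one B
    _ = 3 * B := by simp [Finset.sum_const]

/-- **DISTANCE TO THE BOUNDARY UNDER A BOUNDED ACTION**: for `M ∈ U(2,1)` with entries bounded by `B` and `z` in the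
ball, `1 − nsq (actM M z) ≥ (1 − nsq z) / (9 B²)`. -/
theorem one_sub_nsq_actM_ge {M : Matrix (Fin 3) (Fin 3) ℂ} (hM : Mᴴ * J * M = J) {B : ℝ} (hB : ∀ i j, ‖M i j‖ ≤ B)
    {z : Fin 2 → ℂ} (hz : z ∈ ball) :
    (1 - nsq z) / (9 * B ^ 2) ≤ 1 - nsq (actM M z) := by
  rw [one_sub_nsq_actM hM hz]
  have hden : ‖(M *ᵥ lift3 z) 2‖ ^ 2 ≤ 9 * B ^ 2 := by
    have h := norm_mulVec_lift3_two_le hB hz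
    calc ‖(M *ᵥ lift3 z) 2‖ ^ 2 ≤ (3 * B) ^ 2 := by gcongr
      _ = 9 * B ^ 2 := by ring
  have hpos : 0 < ‖(M *ᵥ lift3 z) 2‖ ^ 2 := by
    have := mulVec_lift3_two_ne_zero hM hz
    positivity
  have hnum : 0 ≤ 1 - nsq z := by
    have : nsq z < 1 := hz
    linarith
  exact div_le_div_of_nonneg_left hnum hpos hden

end Summit.Ventures.HodgeRepro.Tier4.Line3

end
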